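/-
Copyright (c) 2026 the pub-hodgecm-mathlib formalisation cell (harness21).  Prover seat hodgecm-mathlib-LH4-p17 (g4) (Track A «FOUR-FRAME» free hand at the
K2 VALVE, LEAD F0P6-plan (g16) BATCH #302; (σ-A) road desk K2Liu-p25 (g4) WORD (g4) #8), Track B «K2-LIT», #184♮ = hLiu418 = `stmt-HodgeConjecture-24832`;
#42S BLOCK D, row D-2, (σ-A) mini-road, (an-3c) §3b piece (D-out): THE OUTER DOCKING — HANDOFF-D steps 1–5 of K2Liu-p08 (g6): from the stage-B value
`N₂val x = c_N · ∫_ζ ∫_y F_Φ(…)` (★ `chainValues_half_of_placeLetter` clause (h)) to ★ p864562's letters (L1)(L2) with an honest null-cone measure on the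
RESCALED cone slot.  THEOREMS ONLY (no `def`, no `instance`, no `notation`, no named-fact hypothesis, no `sorry`).
-/
import Summits.HodgeConjecture.HodgeConjecture.Theorems.K2LiuConeOuterStage          -- ★ (A) p865116∕p865236: `exists_ne_zero_integral_yStage_eq_integral_cone`, `exists_quadraticForm_conePhase`
import Summits.HodgeConjecture.HodgeConjecture.Theorems.K2LiuConeZetaTransport       -- ★ (L1) p865297: `exists_integral_single_eq_mul_integral_pi`
import Summits.HodgeConjecture.HodgeConjecture.Theorems.K2LiuConeSlotRescaling       -- ★ (λ) p865344: `map_smul_cone_clauses`, `stageLetters_rescale`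
import Summits.HodgeConjecture.HodgeConjecture.Theorems.K2LiuNullConeRadonMeasure    -- ★ (an-1) B p864508: `exists_nullConeMeasure`
import Summits.HodgeConjecture.HodgeConjecture.Theorems.K2LiuConeWordPackage         -- ★ p864773 §0: `vertexLaw_real_of_nnreal` (the consumer's ℝ law form)
import Literature.NumberTheory.Automorphic.UnitaryGroupDoubledBigCellNonsplit          -- ★ `UnitaryGroup.conjLocal_conjLocal` (the involution proof `uMinus` carries)
import HarnessLib

/-!
# Crux `HLiu418`, #42S BLOCK D, row D-2, (σ-A) brick (an-3c) §3b, piece (D-out): THE OUTER DOCKING —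
# the stage-B value of the record corner IS ★ p864562's letters (L1)(L2) on the rescaled null-cone slot

Cell `hodgecm-mathlib`, crux item hLiu418 = `stmt-HodgeConjecture-24832`; squad K2 ∕ K2Liu (L1); prover LH4-p17 (g4).  Lane `--supports stmt-HodgeConjecture-24832
--as helper` (count-neutral helper; closes no socket).

WHY ((D) pen K2Liu-p08's `HANDOFF-D`, steps 1–5).  At a dead NON-SPLIT bad place `v` (`w` the one place above it), the stage-B value of the #42S corner is
`N₂val x = c_N · ∫_ζ ∫_y F_Φ(φ(w₂)·φ(u_{2e₂}(ι y·δ))·φ(w₁)·φ(u_−(ζ e_w))·φ(w₂)·φ(u_{2e₂}(ι x·δ))·h) dμ(y) dμ_w(ζ)` (★ `chainValues_half_of_placeLetter` clause (h), the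
inner double integral, `F_Φ` the local Siegel–Weil section of record).  This file docks it on ★ p864562 `coneWord_of_stageLetters`' letters (L1)(L2) — in the
binder bytes of its consumer ★ p864773 `conePackage_of_stageLetters`, uniformly in `x`, at `κ := Fin 2`, `e := blkIdx M₂ M₂` — with an HONEST cone measure:
1. ★ (L1-transport) p865297: `∫_{E_w} f(ζ e_w) dμ_w = c_H · ∫_{(F_v)^{Fin 2}} f(ι ζ′₀ + ι ζ′₁ δ₁) dμ^{⊗2}` (non-split `w`), so `N₂val x = (c_N c_H) · ∫ N₁raw x ζ′ dμ^{Fin 2}` with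
   `N₁raw x ζ′ := ∫_y F_Φ(φ(w₂)·φ(u(ι y δ))·g(ζ′, x)) dμ`, `g(ζ′, x) := φ(w₁)·φ(u_−(ι ζ′₀ + ι ζ′₁ δ₁))·(φ(w₂)·φ(u(ι x δ))·h)`;
2. ★ (A) p865116∕p865236 `exists_ne_zero_integral_yStage_eq_integral_cone` at the null-cone Radon measure `ν` of the corner phase `Q_f` (★ (an-1) B p864508
   `exists_nullConeMeasure`, clause (1) feeds (A)'s `hν`): `N₁raw x ζ′ = c · ∫ VEC_{g(ζ′,x)}(s ⊔ 0) dν(s)`;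
3. the GRAPH READING, BY VALUE ((B2-coord) FILE B K2Liu-p12 + (B2-read) + corner prefix): `VEC_{g(ζ′,x)}(x₁ ⊔ 0) = c_F′ · V_x((Z_{x₁} ζ′) ⊔ (λ • x₁))`, `λ ≠ 0`,
   `Z_{a•s} ζ = Z_s (a•ζ)` ⇒ (L2′) `N₁raw x ζ′ = (c c_F′) · ∫ V_x((Z_s ζ′) ⊔ (λ•s)) dν(s)`;
4. ★ (λ) p865344 `stageLetters_rescale` + `map_smul_cone_clauses`: `σ″ := (λ•)_* ν`, `N₁ x ζ″ := N₁raw x (λ•ζ″)`, `c_E := c_N c_H |λ|²`, `c_F := c c_F′` give (L1)(L2)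
   VERBATIM, and `σ″` keeps the null-cone clauses (finite on compacts, `σ″{0} = 0`, `σ″{Q_f ≠ 0} = 0`, the vertex law — delivered in ★ p864773's `ℝ` form).
* **`hL1_hL2_of_outerStage`** — the theorem.  BY VALUE (named binders until their payers are ★): `hQf_sep` (the corner phase's polar form is separating —
  FILE B export), the graph reading `hgraph` with `Zm hZbil lam hlam0 cF'`, the record plumbing `hfΦ` (`f (1∕2) = F_Φ`) and `hN₂def` ((h)'s inner integral);
  `Qf hQf` = ★ `exists_quadraticForm_conePhase`'s output kept as a binder so (D) obtains `Q_f` once and shares it with the Witt letter and the charts.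
[cite: KudlaRallis1994, §2 (2.10)–(2.12), §5 (5.3)–(5.6)] [cite: Weil1965, Chap. I n° 2 Lemme 3; Chap. III n° 36–37 Prop. 6] [cite: WeilBNT1967, Chap. I §2, Th. 3 Cor. 3]
HONEST LABEL.  `HC_CM` is proved only modulo the 7 printed citations (2 remaining named inputs: hLiu418 = `stmt-HodgeConjecture-24832`,
h413 = `stmt-HodgeConjecture-24833`) until rung 0 closes; count-neutral helper, closes no socket.  NOT here: (D) proper `K2LiuStageFunctionalConeWordRecord ::
hcone_hZ_of_record` ((C) `hL3`∕`hL4`, the charts, `hWitt`, ★ p864773∕p864878) — it consumes this file BY NAME.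

## References
* [KudlaRallis1994] S. Kudla, S. Rallis, *A regularized Siegel–Weil formula: the first term identity*, Ann. of Math. 140 (1994), §2 (2.10)–(2.12), §5 (5.3)–(5.6).
* [Weil1965] A. Weil, *Sur la formule de Siegel dans la théorie des groupes classiques*, Acta Math. 113 (1965), Chap. I n° 2 Lemme 3; Chap. III n° 36–37 Prop. 6.
* [WeilBNT1967] A. Weil, *Basic Number Theory* (1967), Chap. I §2, Th. 3 Cor. 3; Chap. VII §2 Cor. 1.
-/

set_option autoImplicit false
set_option linter.dupNamespace false -- the mandated namespace repeats `HodgeConjecture.HodgeConjecture`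

noncomputable section

open scoped Matrix Kronecker NNReal ENNReal Classical
open NumberField IsDedekindDomain MeasureTheory Matrix Filter
open Literature.RepresentationTheory.HeisenbergGroup Literature.RepresentationTheory.HeisenbergGroup.SymplecticMatrix
open Literature.NumberTheory.Automorphic Literature.NumberTheory.Automorphic.UnitaryGroup Literature.NumberTheory.Weil1964
open Literature.NumberTheory.Automorphic.UnitaryGroup.QuadraticCoordinates
open Literature.NumberTheory.GaloisRepresentations Literature.NumberTheory.GaloisRepresentations.IsNonarchimedeanLocalField
open Literature.RepresentationTheory.HarrisKudlaSweet1996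
open Literature.NumberTheory.GelbartRogawski1991 Literature.NumberTheory.GelbartRogawski1991.GRConstruction
open Literature.NumberTheory.GelbartRogawski1991.AdaptedBlocks
open Literature.NumberTheory.GelbartRogawski1991.UnitaryDualPair
open Literature.NumberTheory.GelbartRogawski1991.UnitaryDualPair.LocalSplitting
open Literature.NumberTheory.GelbartRogawski1991.UnitaryDualPair.LocalSplitting.FrameTransport
open Literature.NumberTheory.GelbartRogawski1991.UnitaryDualPair.LocalSplitting.DoubledBlock
open Literature.NumberTheory.K2Lit.SiegelDoubled Literature.NumberTheory.K2Lit.LocalSiegelDoubled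
open Summit.HodgeConjecture.HodgeConjecture.Cruxes.HLiu418.K2LiuLocalSWSectionDefs
open Summit.HodgeConjecture.HodgeConjecture.Cruxes.HLiu418.K2LiuLocalSWTensorBlockTransport
open Summit.HodgeConjecture.HodgeConjecture.Cruxes.HLiu418.K2LiuLocalSWTensorBlockFrame
open Summit.HodgeConjecture.HodgeConjecture.Cruxes.HLiu418.K2LiuLocalSWTensorBigCellLetters
open Summit.HodgeConjecture.HodgeConjecture.Cruxes.HLiu418.K2LiuLocalSiegelIwasawa (antidiagonal_over_eq_map)
open Summit.HodgeConjecture.HodgeConjecture.Cruxes.HLiu418.K2LiuDoubledUTwoTwoBorelFrame (uLongTwo uMinus)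
open Summit.HodgeConjecture.HodgeConjecture.Cruxes.HLiu418.K2LiuDoubledUTwoTwoWeylCocycle (weylOne weylTwo)
open Summit.HodgeConjecture.HodgeConjecture.Cruxes.HLiu418.K2LiuDoubledUTwoTwoFrameTransport (toLocalFour)
open Summit.HodgeConjecture.HodgeConjecture.Cruxes.HLiu418.K2LiuLocalSWCornerActionWordsYStage
open Summit.HodgeConjecture.HodgeConjecture.Cruxes.HLiu418.K2LiuConeOuterStage
open Summit.HodgeConjecture.HodgeConjecture.Cruxes.HLiu418.K2LiuConeZetaTransport (exists_integral_single_eq_mul_integral_pi)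
open Summit.HodgeConjecture.HodgeConjecture.Cruxes.HLiu418.K2LiuConeSlotRescaling (map_smul_cone_clauses stageLetters_rescale)
open Summit.HodgeConjecture.HodgeConjecture.Cruxes.HLiu418.K2LiuNullConeRadonMeasure (exists_nullConeMeasure)
open Summit.HodgeConjecture.HodgeConjecture.Cruxes.HLiu418.K2LiuConeWordPackage (vertexLaw_real_of_nnreal)

namespace Summit.HodgeConjecture.HodgeConjecture.Cruxes.HLiu418.K2LiuStageFunctionalOuterDocking

variable (L : Type) [Field L] [NumberField L] [IsCMField L]
variable {N M : ℕ} (e : Fin N × Fin M ≃ Fin 2)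
  (dV : Fin N → L) (hdV : ∀ i, IsCMField.complexConj L (dV i) = dV i)
  (dW : Fin M → L) (hdW : ∀ i, IsCMField.complexConj L (dW i) = dW i)
variable {M₂ M' : ℕ} (eW : Fin M × Fin M₂ ≃ Fin M') (e' : Fin N × Fin M' ≃ Fin (M₂ + M₂))
  (dV' : Fin M₂ → L) (hdV' : ∀ k, IsCMField.complexConj L (dV' k) = dV' k)
  (v : HeightOneSpectrum (𝓞 (Fp L)))
  [MeasurableSpace (v.adicCompletion (Fp L))] [BorelSpace (v.adicCompletion (Fp L))]
  (μ : Measure (v.adicCompletion (Fp L))) [μ.IsAddHaarMeasure]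
  (χ : HeckeCharacter L) (hχ : IsSplittingChar L 1 χ)
  -- the antidiagonal frame of the small doubled group `U(𝕍^𝔻)(L⁺_v)` ([A1-mat])
  (D Dinv : Matrix (Fin 2) (Fin 2) (Fp L)) (hDD : D * Dinv = 1) (Q : GL (Fin (2 + 2)) (Fp L))
  (hQm : (Q : Matrix (Fin (2 + 2)) (Fin (2 + 2)) (Fp L)) = Matrix.reindex (e₂ 2) (e₂ 2) (Matrix.fromBlocks 1 D 1 (-D)))
  (hQ : (Q : Matrix (Fin (2 + 2)) (Fin (2 + 2)) (Fp L))ᵀ * gramD (Fp L) 2 (gramR L e dV hdV dW hdW) * (Q : Matrix (Fin (2 + 2)) (Fin (2 + 2)) (Fp L)) =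
    (StdForm.antidiagonal (2 + 2)).over (Fp L))
  {d₁ d₂ d₁' d₂' : Fp L} (hDa : D = !![0, d₁; d₂, 0]) (hDia : Dinv = !![0, d₁'; d₂', 0])
  -- a flip of the second line (★ `exists_flip_single_hermD … 1`)
  {w₁ : UnitaryGroup.localPi L (IsCMField.complexConj L) (2 + 2) (hermD L e dV hdV dW hdW) v}
  (hw₁ : adapt (matA (Fp L) L (IsCMField.complexConj L) v 2 w₁) =
    Matrix.fromBlocks (1 - Matrix.single 1 1 1) (Matrix.single 1 1 1) (Matrix.single 1 1 1) (1 - Matrix.single 1 1 1))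
  -- the K1a letter's anti-invariant generator `δ` (`u(yδ)`, `u_−`)
  {δ : L} (hcδ : IsCMField.complexConj L δ = -δ) (hδ : δ ≠ 0)

include hDD hQm hDa hDia hw₁ in
set_option maxHeartbeats 1600000 in -- MEASURED ladder: default RED (`isDefEq` on (A)'s restated binders), 800000 RED (`simp_rw [hfΦ]` ∕ `whnf`), 1600000 GREEN (≈100 s) — class of ★ (A) p865116 (the section vector carries the tensor datum twice)
/-- **THE OUTER DOCKING ((D-out); HANDOFF-D steps 1–5).**  With ★ (A)'s data VERBATIM (the tensor datum, the block frame `σ, P, PD`, the block data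
`p₁ hW₁ p₂`, the outer mover-implementer `m₀`, the antidiagonal frame `(D, Dinv, Q)`, a flip `w₁` of the second line, the K1a letter's `δ`), a NON-SPLIT place
(`w` the only place of `L` above `v`, Haar `μ_w` on `L_w`), a ζ-chart generator `δ₁` (`σδ₁ = −δ₁`, `δ₁ ≠ 0`), the corner phase `Q_f` as a quadratic form with its
reading letter `hQf` (★ `exists_quadraticForm_conePhase`) and a SEPARATING polar form (`hQf_sep`, by value), `3 ≤ M₂ + M₂`; the record word BY VALUE: `h`, `Φ`,
the section at `½` `f₀ = F_Φ` (`hfΦ`), `N₂val x = c_N · ∫_ζ ∫_y f₀(φ(w₂)φ(u(yδ))·(φ(w₁)φ(u_−(ζ e_w))·(φ(w₂)φ(u(xδ))·h))) dμ dμ_w` (`hN₂def`, ★ clause (h)'s inner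
integral); and the GRAPH READING BY VALUE (`Zm hZbil lam hlam0 cF' V hgraph`: `VEC_{g(ζ′,x)}(x₁ ⊔ 0) = c_F′ · V_x((Z_{x₁} ζ′) ⊔ (λ • x₁))` for (A)'s vector `VEC_g`
at `g(ζ′,x) = φ(w₁)·φ(u_−(ι ζ′₀ + ι ζ′₁ δ₁))·(φ(w₂)·φ(u(xδ))·h)`).  THEN there are `σ″, N₁, c_E, c_F` with `σ″` finite on compacts, `σ″{0} = 0`, `σ″{Q_f ≠ 0} = 0`,
the vertex law `σ″((𝔭^{n+1})^{M₂+M₂}) = (q^{M₂+M₂})⁻¹ q² · σ″((𝔭^n)^{M₂+M₂})`, and for every `x`: (L1) `N₂val x = c_E · ∫ N₁ x ζ dμ^{Fin 2}(ζ)`,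
(L2) `N₁ x ζ = c_F · ∫ V_x((Z_s ζ) ⊔ s) dσ″(s)` — ★ p864773 `conePackage_of_stageLetters`' `σ hσ0 hσQ hlaw hL1 hL2` at `κ := Fin 2`, `e := blkIdx M₂ M₂`, `Qc := ⇑Q_f`.
Proof: ★ p864508 (the measure `ν` of `Q_f`), ★ (A) at `(Qc := ⇑Q_f) hQf ν`, ★ p865297 (ζ-transport, `c_H`), `hgraph`, ★ p865344 (`σ″ := (λ•)_*ν`, `c_E := c_N c_H |λ|²`,
`c_F := c c_F′`). [cite: KudlaRallis1994, §2 (2.10)–(2.12), §5 (5.3)–(5.6)] [cite: Weil1965, Chap. III n° 36–37 Prop. 6] [cite: WeilBNT1967, Chap. I §2, Th. 3 Cor. 3] -/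
theorem hL1_hL2_of_outerStage (hM₂ : 0 < M₂ + M₂)
    (hT₀d : IsUnit (gramR L e' dV hdV (tensorFrame L dW eW dV') (tensorFrame_real L dW hdW eW dV' hdV')).det)
    {σ : Equiv.Perm (Fin (M₂ + M₂))}
    (hσ₀ : ∀ k, σ (epsV e eW e' (1, k)) = finSumFinEquiv (Sum.inl k)) (hσ₁ : ∀ k, σ (epsV e eW e' (0, k)) = finSumFinEquiv (Sum.inr k))
    {T₁ T₂ : Matrix (Fin M₂) (Fin M₂) (Fp L)}
    (P : GL (Fin (M₂ + M₂)) (Fp L)) (hPσ : (P : Matrix (Fin (M₂ + M₂)) (Fin (M₂ + M₂)) (Fp L)) = σ.toPEquiv.toMatrix)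
    (hP : ((P : Matrix (Fin (M₂ + M₂)) (Fin (M₂ + M₂)) (Fp L)))ᵀ *
        gramR L e' dV hdV (tensorFrame L dW eW dV') (tensorFrame_real L dW hdW eW dV' hdV') * (P : Matrix _ _ (Fp L)) =
      UnitaryGroup.finSum M₂ M₂ T₁ T₂)
    (t' : Fin (M₂ + M₂) → Fp L) (hT' : UnitaryGroup.finSum M₂ M₂ T₁ T₂ = Matrix.diagonal t') (hT₀'d : IsUnit (UnitaryGroup.finSum M₂ M₂ T₁ T₂).det)
    {PD : GL (Fin ((M₂ + M₂) + (M₂ + M₂))) (Fp L)} (hPD : PD = UnitaryGroup.reindexGL (e₂ (M₂ + M₂)) (UnitaryGroup.blockDiagGL (P, P)))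
    (m₀ : LocalMp (Fp L) ((M₂ + M₂) + (M₂ + M₂))
      (gramD (Fp L) (M₂ + M₂) (gramR L e' dV hdV (tensorFrame L dW eW dV') (tensorFrame_real L dW hdW eW dV' hdV'))) v)
    (hm₀ : (deltaLagrangian (Fp L) v (M₂ + M₂)).map (toLin (Fp L) v (MpPsi.proj _ m₀)) = lagrangianY (Fp L) ((M₂ + M₂) + (M₂ + M₂)) v)
    (hM₂' : 0 < M₂) (t₁ : Fin M₂ → Fp L) (hT₁t : T₁ = Matrix.diagonal t₁) (hT₁ : T₁.IsSymm) (hT₂ : T₂.IsSymm)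
    (hT₁d : IsUnit T₁.det) (hT₂d : IsUnit T₂.det)
    (hTv₁ : IsUnit (localGram (Fp L) (M₂ + M₂) (gramD (Fp L) M₂ T₁) v).det)
    (p₁ : LocalMp (Fp L) (M₂ + M₂) (gramD (Fp L) M₂ T₁) v)
    (hp₁ : (deltaLagrangian (Fp L) v M₂).map (toLin (Fp L) v (MpPsi.proj _ p₁)) = lagrangianY (Fp L) (M₂ + M₂) v)
    (B₁ : GL (Fin (M₂ + M₂)) (v.adicCompletion (Fp L)))
    (hW₁ : MpPsi.proj _ p₁ * iotaD (Fp L) L (IsCMField.complexConj L) (complexConj_imagUnit L) (imagUnit_ne_zero L)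
        (imagUnit_mul_self L) v M₂ hT₁ rfl (weylDelta (Fp L) L (IsCMField.complexConj L) v M₂ (T₀ := T₁) rfl) * (MpPsi.proj _ p₁)⁻¹ =
      (transportSp (localGram (Fp L) (M₂ + M₂) (gramD (Fp L) M₂ T₁) v) hTv₁ (SymplecticGroup.symJ _ _))⁻¹ *
        transportSp (localGram (Fp L) (M₂ + M₂) (gramD (Fp L) M₂ T₁) v) hTv₁ (levi B₁))
    {m : ℤ} (hm : (adeleAddCharAt (Fp L) v).HasConductorExp m)
    (p₂ : LocalMp (Fp L) (M₂ + M₂) (gramD (Fp L) M₂ T₂) v)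
    (hp₂ : (deltaLagrangian (Fp L) v M₂).map (toLin (Fp L) v (MpPsi.proj _ p₂)) = lagrangianY (Fp L) (M₂ + M₂) v)
    -- the NON-SPLIT place: `w` the only place of `L` above `v`, a Haar measure on `L_w`
    (w : UnitaryGroup.PlacesOver L v) (hw : ∀ w' : UnitaryGroup.PlacesOver L v, w' = w)
    [MeasurableSpace (w.1.adicCompletion L)] [BorelSpace (w.1.adicCompletion L)] (μw : Measure (w.1.adicCompletion L)) [μw.IsAddHaarMeasure]
    -- the ζ-chart generator
    {δ₁ : L} (hcδ₁ : IsCMField.complexConj L δ₁ = -δ₁) (hδ₁ : δ₁ ≠ 0)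
    -- the cone slot: the corner phase as a quadratic form (★ `exists_quadraticForm_conePhase`), its polar form separating (by value), the dimension floor
    (Qf : QuadraticForm (v.adicCompletion (Fp L)) (Fin (M₂ + M₂) → v.adicCompletion (Fp L)))
    (hQf : ∀ x₁ : Fin (M₂ + M₂) → v.adicCompletion (Fp L), Qf x₁ =
      -(⅟(2 : v.adicCompletion (Fp L)) *
        im (quadraticLocalEquiv L v (IsCMField.complexConj L) (complexConj_imagUnit L) (imagUnit_ne_zero L)).toLinearEquiv.toAddEquiv
          (2 * Matrix.trace (gramS (Fp L) L v 2 (gramR L e dV hdV dW hdW) *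
            !![0, 0; 0, (UnitaryGroup.toLocalRing L v).comp (algebraMap (Fp L) (v.adicCompletion (Fp L))) d₂ * algebraMap L (UnitaryGroup.LocalRing L v) δ] *
            Matrix.of fun j i => ∑ k, ∑ l,
              halfDiff ((eD (Fp L) L (IsCMField.complexConj L) (complexConj_imagUnit L) (imagUnit_ne_zero L) (imagUnit_mul_self L) v (M₂ + M₂)).symm
                  (toLin (Fp L) v
                    (MpPsi.proj _ (frameMp (Fp L) v ((M₂ + M₂) + (M₂ + M₂)) PD (transpose_pd_mul_gramD_mul_pd (Fp L) (M₂ + M₂) P hP hPD)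
                      (boxLoc (Fp L) v M₂ M₂ (T₁ := T₁) (T₂ := T₂) (p₁, p₂))))⁻¹
                    (frameLin (Fp L) v ((M₂ + M₂) + (M₂ + M₂)) PD (glue (blkIdx M₂ M₂) x₁ 0), 0))) (epsV e eW e' (j, l)) *
                gramS (Fp L) L v M₂ (realDiagonal L dV' hdV') k l *
                conjLocal L (IsCMField.complexConj L) v
                  (halfDiff ((eD (Fp L) L (IsCMField.complexConj L) (complexConj_imagUnit L) (imagUnit_ne_zero L) (imagUnit_mul_self L) v (M₂ + M₂)).symm
                    (toLin (Fp L) v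
                      (MpPsi.proj _ (frameMp (Fp L) v ((M₂ + M₂) + (M₂ + M₂)) PD (transpose_pd_mul_gramD_mul_pd (Fp L) (M₂ + M₂) P hP hPD)
                        (boxLoc (Fp L) v M₂ M₂ (T₁ := T₁) (T₂ := T₂) (p₁, p₂))))⁻¹
                      (frameLin (Fp L) v ((M₂ + M₂) + (M₂ + M₂)) PD (glue (blkIdx M₂ M₂) x₁ 0), 0))) (epsV e eW e' (i, k)))))))
    (hQf_sep : (QuadraticMap.associated (R := v.adicCompletion (Fp L)) Qf).SeparatingLeft) (h3 : 3 ≤ M₂ + M₂)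
    -- the record word, by value: the vector `h`, the local Schwartz function `Φ`, the section at `½`, the stage-B value
    (h : UnitaryGroup.localPi L (IsCMField.complexConj L) (2 + 2) (hermD L e dV hdV dW hdW) v)
    (Φ : SchwartzBruhat (Fin ((M₂ + M₂) + (M₂ + M₂)) → v.adicCompletion (Fp L)))
    (f₀ : UnitaryGroup.localPi L (IsCMField.complexConj L) (2 + 2) (hermD L e dV hdV dW hdW) v → ℂ)
    (hfΦ : ∀ g : UnitaryGroup.localPi L (IsCMField.complexConj L) (2 + 2) (hermD L e dV hdV dW hdW) v, f₀ g =
      swSectionTensorLoc L e dV hdV dW hdW eW e' dV' hdV' v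
        (localSplittingDatumCM L v μ (M₂ + M₂)
          (gramR_isSymm L e' dV hdV (tensorFrame L dW eW dV') (tensorFrame_real L dW hdW eW dV' hdV')) hT₀d
          (hermD_eq_map_gramD L e' dV hdV (tensorFrame L dW eW dV') (tensorFrame_real L dW hdW eW dV' hdV')) χ hχ).localSplitting
        m₀ Φ g)
    (cN : ℂ) (N₂val : v.adicCompletion (Fp L) → ℂ)
    (hN₂def : ∀ x : v.adicCompletion (Fp L), N₂val x = cN *
      ∫ ζ, ∫ y,
        f₀ (FrameTransport.frameConj (Fp L) L (IsCMField.complexConj L) v (2 + 2) (hermD_eq_map_gramD L e dV hdV dW hdW) (antidiagonal_over_eq_map (Fp L) L 2) Q hQ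
              (toLocalFour (Fp L) L (IsCMField.complexConj L) v
                (weylTwo (UnitaryGroup.LocalRing L v) (UnitaryGroup.conjLocal L (IsCMField.complexConj L) v))) *
            FrameTransport.frameConj (Fp L) L (IsCMField.complexConj L) v (2 + 2) (hermD_eq_map_gramD L e dV hdV dW hdW) (antidiagonal_over_eq_map (Fp L) L 2) Q hQ
              (toLocalFour (Fp L) L (IsCMField.complexConj L) v
                (uLongTwo (UnitaryGroup.LocalRing L v) (UnitaryGroup.conjLocal L (IsCMField.complexConj L) v)
                  (UnitaryGroup.toLocalRing L v y * algebraMap L (UnitaryGroup.LocalRing L v) δ) (conjLocal_toLocalRing_mul_delta L v hcδ y))) *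
          (FrameTransport.frameConj (Fp L) L (IsCMField.complexConj L) v (2 + 2) (hermD_eq_map_gramD L e dV hdV dW hdW) (antidiagonal_over_eq_map (Fp L) L 2) Q hQ
                (toLocalFour (Fp L) L (IsCMField.complexConj L) v
                  (weylOne (UnitaryGroup.LocalRing L v) (UnitaryGroup.conjLocal L (IsCMField.complexConj L) v))) *
              FrameTransport.frameConj (Fp L) L (IsCMField.complexConj L) v (2 + 2) (hermD_eq_map_gramD L e dV hdV dW hdW) (antidiagonal_over_eq_map (Fp L) L 2) Q hQ
                (toLocalFour (Fp L) L (IsCMField.complexConj L) v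
                  (uMinus (UnitaryGroup.LocalRing L v) (UnitaryGroup.conjLocal L (IsCMField.complexConj L) v)
                    (UnitaryGroup.conjLocal_conjLocal (IsCMField.complexConj L) v hcδ hδ) (Pi.single w ζ))) *
            (FrameTransport.frameConj (Fp L) L (IsCMField.complexConj L) v (2 + 2) (hermD_eq_map_gramD L e dV hdV dW hdW) (antidiagonal_over_eq_map (Fp L) L 2) Q hQ
                  (toLocalFour (Fp L) L (IsCMField.complexConj L) v
                    (weylTwo (UnitaryGroup.LocalRing L v) (UnitaryGroup.conjLocal L (IsCMField.complexConj L) v))) *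
                FrameTransport.frameConj (Fp L) L (IsCMField.complexConj L) v (2 + 2) (hermD_eq_map_gramD L e dV hdV dW hdW) (antidiagonal_over_eq_map (Fp L) L 2) Q hQ
                  (toLocalFour (Fp L) L (IsCMField.complexConj L) v
                    (uLongTwo (UnitaryGroup.LocalRing L v) (UnitaryGroup.conjLocal L (IsCMField.complexConj L) v)
                      (UnitaryGroup.toLocalRing L v x * algebraMap L (UnitaryGroup.LocalRing L v) δ) (conjLocal_toLocalRing_mul_delta L v hcδ x))) *
              h))) ∂μ ∂μw)
    -- the graph reading of the Levi prefix, by value ((B2-coord) FILE B + (B2-read) + corner prefix)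
    (Zm : (Fin (M₂ + M₂) → v.adicCompletion (Fp L)) → ((Fin 2 → v.adicCompletion (Fp L)) →ₗ[v.adicCompletion (Fp L)] (Fin (M₂ + M₂) → v.adicCompletion (Fp L))))
    (hZbil : ∀ (a : v.adicCompletion (Fp L)) (s : Fin (M₂ + M₂) → v.adicCompletion (Fp L)) (ζ : Fin 2 → v.adicCompletion (Fp L)), Zm (a • s) ζ = Zm s (a • ζ))
    (lam : v.adicCompletion (Fp L)) (hlam0 : lam ≠ 0) (cF' : ℂ)
    (V : v.adicCompletion (Fp L) → (Fin ((M₂ + M₂) + (M₂ + M₂)) → v.adicCompletion (Fp L)) → ℂ)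
    (hgraph : ∀ (x : v.adicCompletion (Fp L)) (ζ' : Fin 2 → v.adicCompletion (Fp L)) (x₁ : Fin (M₂ + M₂) → v.adicCompletion (Fp L)),
      ((((MpPsi.toOp _ (boxLoc (Fp L) v M₂ M₂ (T₁ := T₁) (T₂ := T₂) (p₁, p₂))
          ((frameOp (Fp L) v ((M₂ + M₂) + (M₂ + M₂)) PD).symm
            (MpPsi.toRep (localSchrodinger (Fp L) ((M₂ + M₂) + (M₂ + M₂))
              (gramD (Fp L) (M₂ + M₂) (gramR L e' dV hdV (tensorFrame L dW eW dV') (tensorFrame_real L dW hdW eW dV' hdV'))) v)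
            ((localSplittingDatumCM L v μ (M₂ + M₂)
              (gramR_isSymm L e' dV hdV (tensorFrame L dW eW dV') (tensorFrame_real L dW hdW eW dV' hdV')) hT₀d
              (hermD_eq_map_gramD L e' dV hdV (tensorFrame L dW eW dV') (tensorFrame_real L dW hdW eW dV' hdV')) χ hχ).localSplitting
              (tensorEmbLoc L e dV hdV dW hdW eW e' dV' hdV' v
                (w₁ * FrameTransport.frameConj (Fp L) L (IsCMField.complexConj L) v (2 + 2) (hermD_eq_map_gramD L e dV hdV dW hdW)
                    (antidiagonal_over_eq_map (Fp L) L 2) Q hQ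
                    (toLocalFour (Fp L) L (IsCMField.complexConj L) v
                      (weylTwo (UnitaryGroup.LocalRing L v) (UnitaryGroup.conjLocal L (IsCMField.complexConj L) v))) *
                  (FrameTransport.frameConj (Fp L) L (IsCMField.complexConj L) v (2 + 2) (hermD_eq_map_gramD L e dV hdV dW hdW) (antidiagonal_over_eq_map (Fp L) L 2) Q hQ
                        (toLocalFour (Fp L) L (IsCMField.complexConj L) v
                          (weylOne (UnitaryGroup.LocalRing L v) (UnitaryGroup.conjLocal L (IsCMField.complexConj L) v))) *
                      FrameTransport.frameConj (Fp L) L (IsCMField.complexConj L) v (2 + 2) (hermD_eq_map_gramD L e dV hdV dW hdW) (antidiagonal_over_eq_map (Fp L) L 2) Q hQ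
                        (toLocalFour (Fp L) L (IsCMField.complexConj L) v
                          (uMinus (UnitaryGroup.LocalRing L v) (UnitaryGroup.conjLocal L (IsCMField.complexConj L) v)
                            (UnitaryGroup.conjLocal_conjLocal (IsCMField.complexConj L) v hcδ hδ)
                            (quadraticLocalEquiv L v (IsCMField.complexConj L) hcδ₁ hδ₁ (ζ' 0, ζ' 1)))) *
                    (FrameTransport.frameConj (Fp L) L (IsCMField.complexConj L) v (2 + 2) (hermD_eq_map_gramD L e dV hdV dW hdW) (antidiagonal_over_eq_map (Fp L) L 2) Q hQ
                          (toLocalFour (Fp L) L (IsCMField.complexConj L) v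
                            (weylTwo (UnitaryGroup.LocalRing L v) (UnitaryGroup.conjLocal L (IsCMField.complexConj L) v))) *
                        FrameTransport.frameConj (Fp L) L (IsCMField.complexConj L) v (2 + 2) (hermD_eq_map_gramD L e dV hdV dW hdW) (antidiagonal_over_eq_map (Fp L) L 2) Q hQ
                          (toLocalFour (Fp L) L (IsCMField.complexConj L) v
                            (uLongTwo (UnitaryGroup.LocalRing L v) (UnitaryGroup.conjLocal L (IsCMField.complexConj L) v)
                              (UnitaryGroup.toLocalRing L v x * algebraMap L (UnitaryGroup.LocalRing L v) δ) (conjLocal_toLocalRing_mul_delta L v hcδ x))) *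
                      h))))) Φ))) :
          SchwartzBruhat (Fin ((M₂ + M₂) + (M₂ + M₂)) → v.adicCompletion (Fp L)))) :
        (Fin ((M₂ + M₂) + (M₂ + M₂)) → v.adicCompletion (Fp L)) → ℂ) (glue (blkIdx M₂ M₂) x₁ (0 : Fin (M₂ + M₂) → v.adicCompletion (Fp L))) =
      cF' * V x (glue (blkIdx M₂ M₂) (Zm x₁ ζ') (lam • x₁))) :
    ∃ (σ'' : Measure (Fin (M₂ + M₂) → v.adicCompletion (Fp L))) (N₁ : v.adicCompletion (Fp L) → (Fin 2 → v.adicCompletion (Fp L)) → ℂ) (cE cF : ℂ),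
      IsFiniteMeasureOnCompacts σ'' ∧ σ'' {0} = 0 ∧ σ'' {s | Qf s ≠ 0} = 0 ∧
      (∀ n : ℤ, σ''.real (piPrimePowBall (v.adicCompletion (Fp L)) (Fin (M₂ + M₂)) (n + 1)) =
        (((residueFieldCard (v.adicCompletion (Fp L)) : ℝ) ^ Fintype.card (Fin (M₂ + M₂)))⁻¹ * (residueFieldCard (v.adicCompletion (Fp L)) : ℝ) ^ 2) *
          σ''.real (piPrimePowBall (v.adicCompletion (Fp L)) (Fin (M₂ + M₂)) n)) ∧
      (∀ x : v.adicCompletion (Fp L), N₂val x = cE * ∫ ζ, N₁ x ζ ∂(Measure.pi fun _ : Fin 2 => μ)) ∧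
      (∀ (x : v.adicCompletion (Fp L)) (ζ : Fin 2 → v.adicCompletion (Fp L)),
        N₁ x ζ = cF * ∫ s, V x (glue (blkIdx M₂ M₂) (Zm s ζ) s) ∂σ'') := by
  haveI : Algebra.IsQuadraticExtension (Fp L) L := IsCMField.isQuadraticExtension L
  -- (an-1) B: the null-cone Radon measure `ν` of the corner phase `Q_f`
  obtain ⟨v₂, h2⟩ := exists_normAbs_eq_inv_zpow (Invertible.ne_zero (2 : v.adicCompletion (Fp L)))
  have hr : 3 ≤ Fintype.card (Fin (M₂ + M₂)) := by simpa using h3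
  obtain ⟨ν, -, hfin, hν₁, hνQ, hlaw, hν0⟩ := exists_nullConeMeasure μ hm h2 Qf hQf_sep hr
  -- (A): the outer stage at `ν` — ONE `c ≠ 0` for every `g`, `Φ`
  obtain ⟨cA, -, hA⟩ := exists_ne_zero_integral_yStage_eq_integral_cone L e dV hdV dW hdW eW e' dV' hdV' v μ χ hχ D Dinv hDD Q hQm hQ hDa hDia hw₁ hcδ
    hM₂ hT₀d hσ₀ hσ₁ P hPσ hP t' hT' hT₀'d hPD m₀ hm₀ hM₂' t₁ hT₁t hT₁ hT₂ hT₁d hT₂d hTv₁ p₁ hp₁ B₁ hW₁ hm p₂ hp₂ (⇑Qf) hQf ν hν₁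
  -- (L1-transport): the ζ-stage over `L_w` read over `(L⁺_v)^{Fin 2}`
  obtain ⟨cH, -, hT⟩ := exists_integral_single_eq_mul_integral_pi (F := Fp L) L (IsCMField.complexConj L) hcδ₁ hδ₁ v w hw μ μw (G := ℂ)
  -- the raw y-stage value at the transported variable
  obtain ⟨N₁raw, hN₁raw⟩ : ∃ N₁raw : v.adicCompletion (Fp L) → (Fin 2 → v.adicCompletion (Fp L)) → ℂ, ∀ x ζ', N₁raw x ζ' =
      ∫ y, f₀ (FrameTransport.frameConj (Fp L) L (IsCMField.complexConj L) v (2 + 2) (hermD_eq_map_gramD L e dV hdV dW hdW) (antidiagonal_over_eq_map (Fp L) L 2) Q hQ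
              (toLocalFour (Fp L) L (IsCMField.complexConj L) v
                (weylTwo (UnitaryGroup.LocalRing L v) (UnitaryGroup.conjLocal L (IsCMField.complexConj L) v))) *
            FrameTransport.frameConj (Fp L) L (IsCMField.complexConj L) v (2 + 2) (hermD_eq_map_gramD L e dV hdV dW hdW) (antidiagonal_over_eq_map (Fp L) L 2) Q hQ
              (toLocalFour (Fp L) L (IsCMField.complexConj L) v
                (uLongTwo (UnitaryGroup.LocalRing L v) (UnitaryGroup.conjLocal L (IsCMField.complexConj L) v)
                  (UnitaryGroup.toLocalRing L v y * algebraMap L (UnitaryGroup.LocalRing L v) δ) (conjLocal_toLocalRing_mul_delta L v hcδ y))) *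
          (FrameTransport.frameConj (Fp L) L (IsCMField.complexConj L) v (2 + 2) (hermD_eq_map_gramD L e dV hdV dW hdW) (antidiagonal_over_eq_map (Fp L) L 2) Q hQ
                (toLocalFour (Fp L) L (IsCMField.complexConj L) v
                  (weylOne (UnitaryGroup.LocalRing L v) (UnitaryGroup.conjLocal L (IsCMField.complexConj L) v))) *
              FrameTransport.frameConj (Fp L) L (IsCMField.complexConj L) v (2 + 2) (hermD_eq_map_gramD L e dV hdV dW hdW) (antidiagonal_over_eq_map (Fp L) L 2) Q hQ
                (toLocalFour (Fp L) L (IsCMField.complexConj L) v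
                  (uMinus (UnitaryGroup.LocalRing L v) (UnitaryGroup.conjLocal L (IsCMField.complexConj L) v)
                    (UnitaryGroup.conjLocal_conjLocal (IsCMField.complexConj L) v hcδ hδ)
                    (quadraticLocalEquiv L v (IsCMField.complexConj L) hcδ₁ hδ₁ (ζ' 0, ζ' 1)))) *
            (FrameTransport.frameConj (Fp L) L (IsCMField.complexConj L) v (2 + 2) (hermD_eq_map_gramD L e dV hdV dW hdW) (antidiagonal_over_eq_map (Fp L) L 2) Q hQ
                  (toLocalFour (Fp L) L (IsCMField.complexConj L) v
                    (weylTwo (UnitaryGroup.LocalRing L v) (UnitaryGroup.conjLocal L (IsCMField.complexConj L) v))) *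
                FrameTransport.frameConj (Fp L) L (IsCMField.complexConj L) v (2 + 2) (hermD_eq_map_gramD L e dV hdV dW hdW) (antidiagonal_over_eq_map (Fp L) L 2) Q hQ
                  (toLocalFour (Fp L) L (IsCMField.complexConj L) v
                    (uLongTwo (UnitaryGroup.LocalRing L v) (UnitaryGroup.conjLocal L (IsCMField.complexConj L) v)
                      (UnitaryGroup.toLocalRing L v x * algebraMap L (UnitaryGroup.LocalRing L v) δ) (conjLocal_toLocalRing_mul_delta L v hcδ x))) *
              h))) ∂μ := ⟨_, fun _ _ => rfl⟩
  -- (L1-raw): `N₂val x = (c_N c_H) · ∫ N₁raw x ζ′ dμ^{Fin 2}`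
  have hL1raw : ∀ x : v.adicCompletion (Fp L), N₂val x = (cN * (cH : ℂ)) * ∫ ζ', N₁raw x ζ' ∂(Measure.pi fun _ : Fin 2 => μ) := by
    intro x
    have hT2 := hT fun z => ∫ y,
        f₀ (FrameTransport.frameConj (Fp L) L (IsCMField.complexConj L) v (2 + 2) (hermD_eq_map_gramD L e dV hdV dW hdW) (antidiagonal_over_eq_map (Fp L) L 2) Q hQ
              (toLocalFour (Fp L) L (IsCMField.complexConj L) v
                (weylTwo (UnitaryGroup.LocalRing L v) (UnitaryGroup.conjLocal L (IsCMField.complexConj L) v))) *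
            FrameTransport.frameConj (Fp L) L (IsCMField.complexConj L) v (2 + 2) (hermD_eq_map_gramD L e dV hdV dW hdW) (antidiagonal_over_eq_map (Fp L) L 2) Q hQ
              (toLocalFour (Fp L) L (IsCMField.complexConj L) v
                (uLongTwo (UnitaryGroup.LocalRing L v) (UnitaryGroup.conjLocal L (IsCMField.complexConj L) v)
                  (UnitaryGroup.toLocalRing L v y * algebraMap L (UnitaryGroup.LocalRing L v) δ) (conjLocal_toLocalRing_mul_delta L v hcδ y))) *
          (FrameTransport.frameConj (Fp L) L (IsCMField.complexConj L) v (2 + 2) (hermD_eq_map_gramD L e dV hdV dW hdW) (antidiagonal_over_eq_map (Fp L) L 2) Q hQ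
                (toLocalFour (Fp L) L (IsCMField.complexConj L) v
                  (weylOne (UnitaryGroup.LocalRing L v) (UnitaryGroup.conjLocal L (IsCMField.complexConj L) v))) *
              FrameTransport.frameConj (Fp L) L (IsCMField.complexConj L) v (2 + 2) (hermD_eq_map_gramD L e dV hdV dW hdW) (antidiagonal_over_eq_map (Fp L) L 2) Q hQ
                (toLocalFour (Fp L) L (IsCMField.complexConj L) v
                  (uMinus (UnitaryGroup.LocalRing L v) (UnitaryGroup.conjLocal L (IsCMField.complexConj L) v)
                    (UnitaryGroup.conjLocal_conjLocal (IsCMField.complexConj L) v hcδ hδ) z)) *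
            (FrameTransport.frameConj (Fp L) L (IsCMField.complexConj L) v (2 + 2) (hermD_eq_map_gramD L e dV hdV dW hdW) (antidiagonal_over_eq_map (Fp L) L 2) Q hQ
                  (toLocalFour (Fp L) L (IsCMField.complexConj L) v
                    (weylTwo (UnitaryGroup.LocalRing L v) (UnitaryGroup.conjLocal L (IsCMField.complexConj L) v))) *
                FrameTransport.frameConj (Fp L) L (IsCMField.complexConj L) v (2 + 2) (hermD_eq_map_gramD L e dV hdV dW hdW) (antidiagonal_over_eq_map (Fp L) L 2) Q hQ
                  (toLocalFour (Fp L) L (IsCMField.complexConj L) v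
                    (uLongTwo (UnitaryGroup.LocalRing L v) (UnitaryGroup.conjLocal L (IsCMField.complexConj L) v)
                      (UnitaryGroup.toLocalRing L v x * algebraMap L (UnitaryGroup.LocalRing L v) δ) (conjLocal_toLocalRing_mul_delta L v hcδ x))) *
              h))) ∂μ
    rw [hN₂def x, hT2, Complex.real_smul, ← mul_assoc]
    congr 1
    exact integral_congr_ae (Eventually.of_forall fun ζ' => (hN₁raw x ζ').symm)
  -- (L2′): `N₁raw x ζ′ = (c c_F′) · ∫ V_x((Z_s ζ′) ⊔ (λ • s)) dν(s)` — the section letter, ★ (A), the graph reading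
  have hL2raw : ∀ (x : v.adicCompletion (Fp L)) (ζ' : Fin 2 → v.adicCompletion (Fp L)),
      N₁raw x ζ' = (cA * cF') * ∫ s, V x (glue (blkIdx M₂ M₂) (Zm s ζ') (lam • s)) ∂ν := by
    intro x ζ'
    rw [hN₁raw x ζ']
    simp_rw [hfΦ]
    rw [hA _ Φ, mul_assoc cA cF']
    congr 1
    rw [← integral_const_mul]
    exact integral_congr_ae (Eventually.of_forall fun s => hgraph x ζ' s)
  -- (λ): rescale the cone slot — (L1)(L2) verbatim on `σ″ := (λ•)_* ν`
  have hresc := fun x : v.adicCompletion (Fp L) =>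
    stageLetters_rescale μ (blkIdx M₂ M₂) Zm hZbil hlam0 ν x N₂val N₁raw V (cN * (cH : ℂ)) (cA * cF') (hL1raw x) (hL2raw x)
  haveI := hfin
  obtain ⟨hfin', h0', hQ', hlaw'⟩ := map_smul_cone_clauses ν hlam0 hν0 Qf hνQ _ hlaw
  exact ⟨Measure.map (fun s : Fin (M₂ + M₂) → v.adicCompletion (Fp L) => lam • s) ν, fun x ζ => N₁raw x (lam • ζ), _, cA * cF', hfin', h0', hQ',
    vertexLaw_real_of_nnreal _ _ hlaw', fun x => (hresc x).1, fun x ζ => (hresc x).2 ζ⟩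

end Summit.HodgeConjecture.HodgeConjecture.Cruxes.HLiu418.K2LiuStageFunctionalOuterDocking

end
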